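import Summits.MatrixMultiplication.OmegaCensus.NearTilingTwoCosets
import Summits.MatrixMultiplication.OmegaCensus.DihedralLawAttainedCyclic
import Summits.MatrixMultiplication.OmegaCensus.DihedralLikeVertexCounting
import HarnessLib

/-!
# `|A| ≡ 1 (mod 3)`: the pattern `(2, 2, 2q)` attains the law only over `A` with a cyclic subgroup of index ≤ 2

ω-census, family (b3).  Framing: lottery ticket; floor = certified bounds/negative ranges.

Dihedral-like presentation `ρ, τ : A → G`, `|A| = 3q + 1`.  The law is `V ≤ 8q = (8|A| − 8)/3`
(`tpp_volume_le_law_dihedralLike_mod_one`, re-derived by counting in `DihedralLikeLawGap`), attained over cyclic `A`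
by the uniform family of pattern `(2, 2, 2q)`.  Which `A` admit a `(2,2,2q)`-triple attaining it?

**Theorem (`two_cosets_of_two_two_law`).**  If `|A| ≡ 1 (mod 3)`, `|A| ≥ 7`, and a TPP triple with `|S| = |T| = 2`
has `3|S||T||U| + 8 = 8|A|`, then there are `g, a, b ∈ A` with `A = (a + ⟨g⟩) ∪ (b + ⟨g⟩)`: `A` has a cyclic
subgroup of index at most `2`.  (Census data: `ℤ_n`, `ℤ₂ × ℤ₈`, `ℤ₂ × ℤ₁₄`, `ℤ₂ × ℤ₂₀` attain the law; `ℤ₄²`,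
`ℤ₂² × ℤ₄`, `ℤ₂⁴` do not — `β(Dih(ℤ₄²)) = β(Dih(ℤ₂² × ℤ₄)) = 32 = law − 8`; `Dih(ℤ₄²)` pattern `(2,2,10)` UNSAT, kit
j097820 — consistent, as `ℤ₄²` has no cyclic subgroup of index `≤ 2`.)

Proof: the vertex constraints force `S, T` to meet both cosets once and `U`-parts `(q±1, q∓1)` or `(q, q)`; the
sumset triangles then give a near-tiling of `A` by two translates of `U₀` plus `U₁` with defect two
(`two_cosets_of_near_tiling_two`) or with one hole (`two_cosets_of_near_tiling_hole`), generalizing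
`cyclic_of_law_shape` (defect one ⟹ cyclic).
-/

namespace Summit.MatrixMultiplication.OmegaCensus

open Literature.Combinatorics.Additive Finset

section DihedralLike

variable {A : Type*} [AddCommGroup A] [DecidableEq A] [Fintype A] {G : Type} [Group G] [DecidableEq G]
  {ρ τ : A → G} {c₀ : A} {S T U : Finset G}

/-- **Shape `(1,1 | 1,1 | q+1,q−1)`: at most two cosets.** A TPP triple with `S = {ρs, τs'}`, `T = {ρt, τt'}` and
`U`-parts of sizes `(q+1, q−1)` with `2(q+1) + (q−1) = |A|` (or mirrored) forces `A` to be the union of at most two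
cosets of `⟨(s'+t) − (s+t')⟩`. [folklore] -/
theorem two_cosets_of_law_shape_two (hρρ : ∀ a b, ρ a * ρ b = ρ (a + b)) (hρτ : ∀ a b, ρ a * τ b = τ (b - a))
    (hτρ : ∀ a b, τ a * ρ b = τ (a + b)) (hττ : ∀ a b, τ a * τ b = ρ (c₀ + b - a))
    (hρ : Function.Injective ρ) (hτ : Function.Injective τ) (hne : ∀ a b, ρ a ≠ τ b)
    (h : TripleProductProperty S T U)
    (hs₀ : (univ.filter fun a : A => ρ a ∈ S).card = 1) (hs₁ : (univ.filter fun a : A => τ a ∈ S).card = 1)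
    (ht₀ : (univ.filter fun a : A => ρ a ∈ T).card = 1) (ht₁ : (univ.filter fun a : A => τ a ∈ T).card = 1)
    (hu : ((univ.filter fun a : A => ρ a ∈ U).card = (univ.filter fun a : A => τ a ∈ U).card + 2 ∧
        2 * (univ.filter fun a : A => ρ a ∈ U).card + (univ.filter fun a : A => τ a ∈ U).card = Fintype.card A) ∨
      ((univ.filter fun a : A => τ a ∈ U).card = (univ.filter fun a : A => ρ a ∈ U).card + 2 ∧
        2 * (univ.filter fun a : A => τ a ∈ U).card + (univ.filter fun a : A => ρ a ∈ U).card = Fintype.card A)) :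
    ∃ g a b : A, ∀ x : A, x - a ∈ AddSubgroup.zmultiples g ∨ x - b ∈ AddSubgroup.zmultiples g := by
  set U₀ : Finset A := univ.filter fun a => ρ a ∈ U with hU₀
  set U₁ : Finset A := univ.filter fun a => τ a ∈ U with hU₁
  obtain ⟨s, hsS⟩ := card_eq_one.1 hs₀
  obtain ⟨s', hsS'⟩ := card_eq_one.1 hs₁
  obtain ⟨t, htT⟩ := card_eq_one.1 ht₀
  obtain ⟨t', htT'⟩ := card_eq_one.1 ht₁
  have ms : ρ s ∈ S := by
    have hm := mem_singleton_self s; rw [← hsS] at hm; exact (mem_filter.1 hm).2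
  have ms' : τ s' ∈ S := by
    have hm := mem_singleton_self s'; rw [← hsS'] at hm; exact (mem_filter.1 hm).2
  have mt : ρ t ∈ T := by
    have hm := mem_singleton_self t; rw [← htT] at hm; exact (mem_filter.1 hm).2
  have mt' : τ t' ∈ T := by
    have hm := mem_singleton_self t'; rw [← htT'] at hm; exact (mem_filter.1 hm).2
  have mρs : ∀ a ∈ ({s} : Finset A), ρ a ∈ S := fun a ha => by rw [mem_singleton.1 ha]; exact ms
  have mτs' : ∀ a ∈ ({s'} : Finset A), τ a ∈ S := fun a ha => by rw [mem_singleton.1 ha]; exact ms'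
  have mρt : ∀ a ∈ ({t} : Finset A), ρ a ∈ T := fun a ha => by rw [mem_singleton.1 ha]; exact mt
  have mτt' : ∀ a ∈ ({t'} : Finset A), τ a ∈ T := fun a ha => by rw [mem_singleton.1 ha]; exact mt'
  have mρs_c : ∀ a ∈ ({s} : Finset A), cond false (τ a) (ρ a) ∈ S := mρs
  have mτs'_c : ∀ a ∈ ({s'} : Finset A), cond true (τ a) (ρ a) ∈ S := mτs'
  have mρt_c : ∀ a ∈ ({t} : Finset A), cond false (τ a) (ρ a) ∈ T := mρt
  have mτt'_c : ∀ a ∈ ({t'} : Finset A), cond true (τ a) (ρ a) ∈ T := mτt'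
  have mU₀ : ∀ a ∈ U₀, ρ a ∈ U := fun a ha => (mem_filter.1 ha).2
  have mU₁ : ∀ a ∈ U₁, τ a ∈ U := fun a ha => (mem_filter.1 ha).2
  have mU₀_c : ∀ a ∈ U₀, cond false (τ a) (ρ a) ∈ U := mU₀
  have mU₁_c : ∀ a ∈ U₁, cond true (τ a) (ρ a) ∈ U := mU₁
  have cs := card_sumset' hρρ hττ hρ hτ h
  have d₁ := disjoint_sumset₁' hρρ hρτ hτρ hττ hne h
  have d₂ := disjoint_sumset₂' hρρ hρτ hτρ hττ hne h
  have d₃ := disjoint_sumset₃' hρρ hρτ hτρ hττ hne h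
  -- the four relevant sumsets
  have cY := cs false true false mρs_c mτt'_c mU₀_c   -- |s + t' + U₀| = |U₀|
  have cZ := cs false false true mρs_c mρt_c mU₁_c   -- |s + t + U₁| = |U₁|
  have cX' := cs false true true mρs_c mτt'_c mU₁_c   -- |s + t' + U₁| = |U₁|
  have cZ' := cs true true false mτs'_c mτt'_c mU₀_c  -- |s' + t' + U₀| = |U₀|
  simp only [card_singleton, one_mul] at cY cZ cX' cZ'
  have hXY := d₁ false mτs' mρt mU₀_c mρs mτt'    -- `X ∩ Y = ∅`
  have hX'Y' := d₁ true mτs' mρt mU₁_c mρs mτt'   -- `Y' ∩ X' = ∅`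
  rcases hu with ⟨hcard, hsum⟩ | ⟨hcard, hsum⟩
  · -- triangle 1 tiles: `P = s + t' + U₀`, `P + d = s' + t + U₀`, `C = s + t + U₁`
    have hPimg := image_sumset_pair_shift s t' s' t U₀
    refine ⟨s' + t - (s + t'), two_cosets_of_near_tiling_two
      (P := (({s} : Finset A) ×ˢ ({t'} : Finset A) ×ˢ U₀).image fun p : A × A × A => p.1 + p.2.1 + p.2.2)
      (C := (({s} : Finset A) ×ˢ ({t} : Finset A) ×ˢ U₁).image fun p : A × A × A => p.1 + p.2.1 + p.2.2)
      (d₂ false mρs_c mτt' mU₀ mρs_c mρt mU₁) ?_ ?_ ?_ ?_ ?_⟩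
    · rw [hPimg]; exact (d₃ false mρs mρt_c mU₁ mτs' mU₀).symm
    · apply eq_univ_of_card
      rw [card_union_of_disjoint (disjoint_union_left.2 ⟨d₂ false mρs_c mτt' mU₀ mρs_c mρt mU₁,
        by rw [hPimg]; exact (d₃ false mρs mρt_c mU₁ mτs' mU₀).symm⟩),
        card_union_of_disjoint (by rw [hPimg]; exact (hXY).symm), card_image_of_injective _ (add_left_injective _),
        cY, cZ]
      omega
    · rw [disjoint_left]
      intro x hx hx'
      rw [mem_sumset₃] at hx
      obtain ⟨a, ha, b, hb, c₁, hc₁, rfl⟩ := hx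
      rw [mem_singleton] at ha hb
      subst a
      subst b
      obtain ⟨y, hy, hyx⟩ := mem_image.1 hx'
      rw [mem_sumset₃] at hy
      obtain ⟨a, ha, b, hb, c₂, hc₂, rfl⟩ := hy
      rw [mem_singleton] at ha hb
      subst a
      subst b
      -- `z = s + t' + c₁ = s' + t + c₂` lies in `X' ∩ Y'`
      have hz1 : s' + t + c₂ ∈ ((({s'} : Finset A) ×ˢ ({t} : Finset A) ×ˢ U₁).image
          fun p : A × A × A => p.1 + p.2.1 + p.2.2) :=
        mem_sumset₃.2 ⟨s', mem_singleton_self _, t, mem_singleton_self _, c₂, hc₂, rfl⟩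
      have hz2 : s' + t + c₂ ∈ ((({s} : Finset A) ×ˢ ({t'} : Finset A) ×ˢ U₁).image
          fun p : A × A × A => p.1 + p.2.1 + p.2.2) :=
        mem_sumset₃.2 ⟨s, mem_singleton_self _, t', mem_singleton_self _, c₁, hc₁, by
          rw [← sub_eq_zero]; rw [← sub_eq_zero] at hyx
          have e : s + t' + c₁ - (s' + t + c₂) = -(s + t + c₂ + (s' + t - (s + t')) - (s + t + c₁)) := by abel
          rw [e, hyx, neg_zero]⟩
      exact disjoint_left.1 hX'Y' hz1 hz2
    · rw [cY, cZ, hcard]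
    · rw [hPimg]; exact hXY.symm
  · -- triangle 2 tiles: `P = s + t' + U₁`, `P + d = s' + t + U₁`, `C = s' + t' + U₀`
    have hPimg := image_sumset_pair_shift s t' s' t U₁
    refine ⟨s' + t - (s + t'), two_cosets_of_near_tiling_two
      (P := (({s} : Finset A) ×ˢ ({t'} : Finset A) ×ˢ U₁).image fun p : A × A × A => p.1 + p.2.1 + p.2.2)
      (C := (({s'} : Finset A) ×ˢ ({t'} : Finset A) ×ˢ U₀).image fun p : A × A × A => p.1 + p.2.1 + p.2.2)
      (d₃ true mρs mτt'_c mU₁ mτs' mU₀) ?_ ?_ ?_ ?_ ?_⟩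
    · rw [hPimg]; exact (d₂ true mτs'_c mτt' mU₀ mτs'_c mρt mU₁).symm
    · apply eq_univ_of_card
      rw [card_union_of_disjoint (disjoint_union_left.2 ⟨d₃ true mρs mτt'_c mU₁ mτs' mU₀,
        by rw [hPimg]; exact (d₂ true mτs'_c mτt' mU₀ mτs'_c mρt mU₁).symm⟩),
        card_union_of_disjoint (by rw [hPimg]; exact hX'Y'.symm), card_image_of_injective _ (add_left_injective _),
        cX', cZ']
      omega
    · rw [disjoint_left]
      intro x hx hx'
      rw [mem_sumset₃] at hx
      obtain ⟨a, ha, b, hb, c₁, hc₁, rfl⟩ := hx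
      rw [mem_singleton] at ha hb
      subst a
      subst b
      obtain ⟨y, hy, hyx⟩ := mem_image.1 hx'
      rw [mem_sumset₃] at hy
      obtain ⟨a, ha, b, hb, c₂, hc₂, rfl⟩ := hy
      rw [mem_singleton] at ha hb
      subst a
      subst b
      -- `z = s + t' + c₁ = s' + t + c₂` lies in `X ∩ Y`
      have hz1 : s' + t + c₂ ∈ ((({s'} : Finset A) ×ˢ ({t} : Finset A) ×ˢ U₀).image
          fun p : A × A × A => p.1 + p.2.1 + p.2.2) :=
        mem_sumset₃.2 ⟨s', mem_singleton_self _, t, mem_singleton_self _, c₂, hc₂, rfl⟩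
      have hz2 : s' + t + c₂ ∈ ((({s} : Finset A) ×ˢ ({t'} : Finset A) ×ˢ U₀).image
          fun p : A × A × A => p.1 + p.2.1 + p.2.2) :=
        mem_sumset₃.2 ⟨s, mem_singleton_self _, t', mem_singleton_self _, c₁, hc₁, by
          rw [← sub_eq_zero]; rw [← sub_eq_zero] at hyx
          have e : s + t' + c₁ - (s' + t + c₂) = -(s' + t' + c₂ + (s' + t - (s + t')) - (s' + t' + c₁)) := by abel
          rw [e, hyx, neg_zero]⟩
      exact disjoint_left.1 hXY hz1 hz2
    · rw [cX', cZ', hcard]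
    · rw [hPimg]; exact hX'Y'.symm

/-- **Shape `(1,1 | 1,1 | q,q)`: at most two cosets.** A TPP triple with `S = {ρs, τs'}`, `T = {ρt, τt'}` and
`U`-parts of equal size `q` with `3q + 1 = |A|` forces `A` to be the union of at most two cosets of
`⟨(s'+t) − (s+t')⟩`. [folklore] -/
theorem two_cosets_of_law_shape_hole (hρρ : ∀ a b, ρ a * ρ b = ρ (a + b)) (hρτ : ∀ a b, ρ a * τ b = τ (b - a))
    (hτρ : ∀ a b, τ a * ρ b = τ (a + b)) (hττ : ∀ a b, τ a * τ b = ρ (c₀ + b - a))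
    (hρ : Function.Injective ρ) (hτ : Function.Injective τ) (hne : ∀ a b, ρ a ≠ τ b)
    (h : TripleProductProperty S T U)
    (hs₀ : (univ.filter fun a : A => ρ a ∈ S).card = 1) (hs₁ : (univ.filter fun a : A => τ a ∈ S).card = 1)
    (ht₀ : (univ.filter fun a : A => ρ a ∈ T).card = 1) (ht₁ : (univ.filter fun a : A => τ a ∈ T).card = 1)
    (hu : (univ.filter fun a : A => ρ a ∈ U).card = (univ.filter fun a : A => τ a ∈ U).card ∧
        3 * (univ.filter fun a : A => ρ a ∈ U).card + 1 = Fintype.card A) :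
    ∃ g a b : A, ∀ x : A, x - a ∈ AddSubgroup.zmultiples g ∨ x - b ∈ AddSubgroup.zmultiples g := by
  set U₀ : Finset A := univ.filter fun a => ρ a ∈ U with hU₀
  set U₁ : Finset A := univ.filter fun a => τ a ∈ U with hU₁
  obtain ⟨s, hsS⟩ := card_eq_one.1 hs₀
  obtain ⟨s', hsS'⟩ := card_eq_one.1 hs₁
  obtain ⟨t, htT⟩ := card_eq_one.1 ht₀
  obtain ⟨t', htT'⟩ := card_eq_one.1 ht₁
  have ms : ρ s ∈ S := by
    have hm := mem_singleton_self s; rw [← hsS] at hm; exact (mem_filter.1 hm).2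
  have ms' : τ s' ∈ S := by
    have hm := mem_singleton_self s'; rw [← hsS'] at hm; exact (mem_filter.1 hm).2
  have mt : ρ t ∈ T := by
    have hm := mem_singleton_self t; rw [← htT] at hm; exact (mem_filter.1 hm).2
  have mt' : τ t' ∈ T := by
    have hm := mem_singleton_self t'; rw [← htT'] at hm; exact (mem_filter.1 hm).2
  have mρs : ∀ a ∈ ({s} : Finset A), ρ a ∈ S := fun a ha => by rw [mem_singleton.1 ha]; exact ms
  have mτs' : ∀ a ∈ ({s'} : Finset A), τ a ∈ S := fun a ha => by rw [mem_singleton.1 ha]; exact ms'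
  have mρt : ∀ a ∈ ({t} : Finset A), ρ a ∈ T := fun a ha => by rw [mem_singleton.1 ha]; exact mt
  have mτt' : ∀ a ∈ ({t'} : Finset A), τ a ∈ T := fun a ha => by rw [mem_singleton.1 ha]; exact mt'
  have mρs_c : ∀ a ∈ ({s} : Finset A), cond false (τ a) (ρ a) ∈ S := mρs
  have mτs'_c : ∀ a ∈ ({s'} : Finset A), cond true (τ a) (ρ a) ∈ S := mτs'
  have mρt_c : ∀ a ∈ ({t} : Finset A), cond false (τ a) (ρ a) ∈ T := mρt
  have mτt'_c : ∀ a ∈ ({t'} : Finset A), cond true (τ a) (ρ a) ∈ T := mτt'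
  have mU₀ : ∀ a ∈ U₀, ρ a ∈ U := fun a ha => (mem_filter.1 ha).2
  have mU₁ : ∀ a ∈ U₁, τ a ∈ U := fun a ha => (mem_filter.1 ha).2
  have mU₀_c : ∀ a ∈ U₀, cond false (τ a) (ρ a) ∈ U := mU₀
  have mU₁_c : ∀ a ∈ U₁, cond true (τ a) (ρ a) ∈ U := mU₁
  have cs := card_sumset' hρρ hττ hρ hτ h
  have d₁ := disjoint_sumset₁' hρρ hρτ hτρ hττ hne h
  have d₂ := disjoint_sumset₂' hρρ hρτ hτρ hττ hne h
  have d₃ := disjoint_sumset₃' hρρ hρτ hτρ hττ hne h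
  -- the four relevant sumsets
  have cY := cs false true false mρs_c mτt'_c mU₀_c   -- |s + t' + U₀| = |U₀|
  have cZ := cs false false true mρs_c mρt_c mU₁_c   -- |s + t + U₁| = |U₁|
  have cX' := cs false true true mρs_c mτt'_c mU₁_c   -- |s + t' + U₁| = |U₁|
  have cZ' := cs true true false mτs'_c mτt'_c mU₀_c  -- |s' + t' + U₀| = |U₀|
  simp only [card_singleton, one_mul] at cY cZ cX' cZ'
  have hXY := d₁ false mτs' mρt mU₀_c mρs mτt'    -- `X ∩ Y = ∅`
  have hX'Y' := d₁ true mτs' mρt mU₁_c mρs mτt'   -- `Y' ∩ X' = ∅`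
  obtain ⟨hcard, hsum⟩ := hu
  -- triangle 1: `P = s + t' + U₀`, `P + d = s' + t + U₀`, `C = s + t + U₁` cover all but one point `η`
  have hPimg := image_sumset_pair_shift s t' s' t U₀
  set P : Finset A := (({s} : Finset A) ×ˢ ({t'} : Finset A) ×ˢ U₀).image fun p : A × A × A => p.1 + p.2.1 + p.2.2
    with hPdef
  set C : Finset A := (({s} : Finset A) ×ˢ ({t} : Finset A) ×ˢ U₁).image fun p : A × A × A => p.1 + p.2.1 + p.2.2
    with hCdef
  have hPC : Disjoint P C := d₂ false mρs_c mτt' mU₀ mρs_c mρt mU₁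
  have hPdC : Disjoint (P.image fun x => x + (s' + t - (s + t'))) C := by
    rw [hPdef, hPimg]; exact (d₃ false mρs mρt_c mU₁ mτs' mU₀).symm
  have hPP : Disjoint P (P.image fun x => x + (s' + t - (s + t'))) := by
    rw [hPdef, hPimg]; exact hXY.symm
  have hXcard : (P ∪ P.image (fun x => x + (s' + t - (s + t'))) ∪ C).card + 1 = Fintype.card A := by
    rw [card_union_of_disjoint (disjoint_union_left.2 ⟨hPC, hPdC⟩), card_union_of_disjoint hPP,
      card_image_of_injective _ (add_left_injective _), hPdef, hCdef, cY, cZ]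
    omega
  obtain ⟨η, hη⟩ : ∃ η, univ \ (P ∪ P.image (fun x => x + (s' + t - (s + t'))) ∪ C) = {η} :=
    card_eq_one.1 (by rw [card_sdiff_of_subset (subset_univ _), card_univ]; omega)
  have hηmem : η ∈ univ \ (P ∪ P.image (fun x => x + (s' + t - (s + t'))) ∪ C) := by rw [hη]; exact mem_singleton_self η
  have hηnot := (mem_sdiff.1 hηmem).2
  simp only [mem_union, not_or] at hηnot
  have hcov : P ∪ P.image (fun x => x + (s' + t - (s + t'))) ∪ C ∪ {η} = univ := by
    rw [← hη, union_sdiff_of_subset (subset_univ _)]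
  refine ⟨s' + t - (s + t'), two_cosets_of_near_tiling_hole hPC hPdC hPP hηnot.1.1 hηnot.1.2 hηnot.2 hcov ?_ ?_⟩
  · rw [disjoint_left]
    intro x hx hx'
    rw [hCdef, mem_sumset₃] at hx
    obtain ⟨a, ha, b, hb, c₁, hc₁, rfl⟩ := hx
    rw [mem_singleton] at ha hb
    subst a
    subst b
    obtain ⟨y, hy, hyx⟩ := mem_image.1 hx'
    rw [hCdef, mem_sumset₃] at hy
    obtain ⟨a, ha, b, hb, c₂, hc₂, rfl⟩ := hy
    rw [mem_singleton] at ha hb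
    subst a
    subst b
    have hz1 : s' + t + c₂ ∈ ((({s'} : Finset A) ×ˢ ({t} : Finset A) ×ˢ U₁).image
        fun p : A × A × A => p.1 + p.2.1 + p.2.2) :=
      mem_sumset₃.2 ⟨s', mem_singleton_self _, t, mem_singleton_self _, c₂, hc₂, rfl⟩
    have hz2 : s' + t + c₂ ∈ ((({s} : Finset A) ×ˢ ({t'} : Finset A) ×ˢ U₁).image
        fun p : A × A × A => p.1 + p.2.1 + p.2.2) :=
      mem_sumset₃.2 ⟨s, mem_singleton_self _, t', mem_singleton_self _, c₁, hc₁, by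
        rw [← sub_eq_zero]; rw [← sub_eq_zero] at hyx
        have e : s + t' + c₁ - (s' + t + c₂) = -(s + t + c₂ + (s' + t - (s + t')) - (s + t + c₁)) := by abel
        rw [e, hyx, neg_zero]⟩
    exact disjoint_left.1 hX'Y' hz1 hz2
  · rw [hPdef, hCdef, cY, cZ, hcard]


/-- **`|A| ≡ 1 (mod 3)`: a TPP triple with `|S| = |T| = 2` attains the law `(8|A|−8)/3` only if `A` is the union
of two cosets of a cyclic subgroup** (`|A| ≥ 7`; any `c₀`). [folklore] -/
theorem two_cosets_of_two_two_law
    (hρρ : ∀ a b, ρ a * ρ b = ρ (a + b)) (hρτ : ∀ a b, ρ a * τ b = τ (b - a))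
    (hτρ : ∀ a b, τ a * ρ b = τ (a + b)) (hττ : ∀ a b, τ a * τ b = ρ (c₀ + b - a))
    (hρ : Function.Injective ρ) (hτ : Function.Injective τ) (hne : ∀ a b, ρ a ≠ τ b)
    (hsurj : ∀ g, (∃ a, ρ a = g) ∨ (∃ a, τ a = g)) (hmod : Fintype.card A % 3 = 1) (hA : 7 ≤ Fintype.card A)
    (h : TripleProductProperty S T U) (hS : S.card = 2) (hT : T.card = 2)
    (hV : 3 * (S.card * T.card * U.card) + 8 = 8 * Fintype.card A) :
    ∃ g a b : A, ∀ x : A, x - a ∈ AddSubgroup.zmultiples g ∨ x - b ∈ AddSubgroup.zmultiples g := by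
  obtain ⟨h000, h111, h100, h011, h010, h101, h001, h110⟩ := vertex_counting' hρρ hρτ hτρ hττ hρ hτ hne h
  rw [card_eq_parts' hρ hτ hne hsurj S] at hS hV
  rw [card_eq_parts' hρ hτ hne hsurj T] at hT hV
  rw [card_eq_parts' hρ hτ hne hsurj U] at hV
  set s₀ := (univ.filter fun a : A => ρ a ∈ S).card with hs₀
  set s₁ := (univ.filter fun a : A => τ a ∈ S).card with hs₁
  set t₀ := (univ.filter fun a : A => ρ a ∈ T).card with ht₀
  set t₁ := (univ.filter fun a : A => τ a ∈ T).card with ht₁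
  set u₀ := (univ.filter fun a : A => ρ a ∈ U).card with hu₀
  set u₁ := (univ.filter fun a : A => τ a ∈ U).card with hu₁
  -- `S` and `T` meet both cosets exactly once
  have hsv : s₀ = 0 ∨ s₀ = 1 ∨ s₀ = 2 := by omega
  have htv : t₀ = 0 ∨ t₀ = 1 ∨ t₀ = 2 := by omega
  rcases hsv with hs0 | hs0 | hs0 <;> rcases htv with ht0 | ht0 | ht0 <;>
    · have hs1 : s₁ = 2 - s₀ := by omega
      have ht1 : t₁ = 2 - t₀ := by omega
      rw [hs1, ht1, hs0, ht0] at h000 h111 h100 h011 h010 h101 h001 h110 hV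
      norm_num at h000 h111 h100 h011 h010 h101 h001 h110 hV
      first
        | (exfalso; omega)
        | -- the case `s₀ = s₁ = t₀ = t₁ = 1`
          have hs1' : s₁ = 1 := by omega
          have ht1' : t₁ = 1 := by omega
          have hu3 : (u₀ = u₁ + 2 ∧ 2 * u₀ + u₁ = Fintype.card A) ∨ (u₁ = u₀ + 2 ∧ 2 * u₁ + u₀ = Fintype.card A) ∨
              (u₀ = u₁ ∧ 3 * u₀ + 1 = Fintype.card A) := by omega
          rcases hu3 with hu | hu | hu
          · exact two_cosets_of_law_shape_two hρρ hρτ hτρ hττ hρ hτ hne h hs0 hs1' ht0 ht1' (Or.inl hu)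
          · exact two_cosets_of_law_shape_two hρρ hρτ hτρ hττ hρ hτ hne h hs0 hs1' ht0 ht1' (Or.inr hu)
          · exact two_cosets_of_law_shape_hole hρρ hρτ hτρ hττ hρ hτ hne h hs0 hs1' ht0 ht1' hu

end DihedralLike

end Summit.MatrixMultiplication.OmegaCensus
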